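import Literature.NumberTheory.GaloisRepresentations.LubinTateNormGroup
import HarnessLib

/-!
# Zeros of integral power series near the unit circle; uniqueness of Coleman's power series

De Shalit, *Iwasawa theory of elliptic curves with complex multiplication* (1987), Ch. I §2.2,
Theorem (Coleman): for a norm-coherent sequence `β = (β_n)` in the Lubin–Tate tower there is a
**unique** `g_β ∈ 𝒪'⟦X⟧ˣ` with `g_β(ω_n) = β_n` for all `n`; "the Weierstrass preparation theorem
shows that `g = g_β` is unique". This file proves the uniqueness half, in the following elementary
form which avoids Weierstrass preparation: a non-zero `d ∈ 𝒪_F⟦X⟧` has no zeros among the points `x`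
of the open unit disc (of any finite extension `E/F`) with `‖π‖ < ‖x‖^N`, for some `N` depending on
`d` only (`N` = the Weierstrass degree of `d/π^a`); since the division points `λ_{n+1}` of the
Lubin–Tate group of `f = πX + X^q` satisfy `‖λ_{n+1}‖^{(q-1)qⁿ} = ‖π‖`, a series vanishing at
primitive division points of infinitely many levels is `0`.

## Contents (everything proved)

* `norm_aeval_eq_of_dominant` — the dominant-term computation in a complete ultrametric field `L`:
  if `G ∈ 𝒪_L⟦X⟧` has `‖G_s‖ = 1` and `‖G_k‖ ≤ c < ‖ω‖^s` for `k < s`, then `‖G(ω)‖ = ‖ω‖^s`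
  (`‖ω‖ < 1`).
* `exists_eq_C_pow_mul` — every non-zero `d ∈ 𝒪_F⟦X⟧` is `π^a · d₀` with `d₀` having a unit
  coefficient in some degree `s` and all lower coefficients divisible by `π` (the `π`-content and the
  Weierstrass degree).
* `norm_evalAt_eq_of_isUnit_coeff` — for such `d₀` and a point `x ∈ 𝔪_E` with `‖π‖ < ‖x‖^s`:
  `‖d₀(x)‖ = ‖x‖^s`; hence `exists_forall_evalAt_ne_zero`: **a non-zero `d` does not vanish at any
  point `x` with `‖π‖ < ‖x‖^N`**.
* `norm_ltSMul_of_isUnit` — `‖[u] x‖ = ‖x‖` for a unit `u` and any point `x` (all primitive division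
  points of level `n+1` have the same absolute value), and `norm_pi_lt_norm_genPt_pow` —
  `‖π‖ < ‖λ_{n+1}‖^N` as soon as `N < (q-1)qⁿ`.
* **`eq_zero_of_frequently_evalAt_ltSMul_genPt_eq_zero`** — if `d([u_n] λ_{n+1}) = 0` for
  infinitely many `n` (`u_n ∈ 𝒪_Fˣ` arbitrary), then `d = 0`; the two-series form
  `eq_of_frequently_evalAt_ltSMul_genPt_eq` — **uniqueness of the Coleman power series**
  (de Shalit I §2.2, uniqueness; Coleman 1979 Thm. A, uniqueness) — and the form at the canonical
  generators `eq_zero_of_frequently_evalAt_genPt_eq_zero`.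

## References

* E. de Shalit, *Iwasawa theory of elliptic curves with complex multiplication*, Perspectives in
  Math. 3, Academic Press (1987), Ch. I §2.2 Theorem (proof, last paragraph). [cite: deShalit1987, Ch. I §2.2]
* R. Coleman, *Division values in local fields*, Invent. Math. 53 (1979), Thm. A.

## Mathlib reuse

`Summable.tsum_eq_add_tsum_ite`, `IsUltrametricDist.norm_tsum_le_of_forall_le_of_nonneg`,
`IsUltrametricDist.norm_add_eq_max_of_norm_ne_norm`, `Nat.find`, `Filter.Frequently`; from the tree:
`LubinTateColeman.lean` (`evalAt`, `evalAt_eq_evS_map`, `aeval_eq_tsum_coeff_mul_pow`,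
`summable_coeff_mul_pow`), `LubinTateNormOperator.lean` (`norm_algebraMap_LTCoeff`, `dvd_of_norm_lt_one`),
`LubinTateNormGroup.lean` (`norm_gen_ltField_pow`, `evalAt_X'`), `LubinTateTorsion.lean` (`genPt`,
`exists_eq_pow_mul_unit`, local instances `rk1 nF nE`).
-/

noncomputable section

open Filter Topology Polynomial ValuativeRel
open scoped PowerSeries.WithPiTopology

namespace Literature.NumberTheory.GaloisRepresentations

namespace LubinTate

/-! ### The dominant term of `G(ω)` in a complete ultrametric field -/

section Dominant

variable {L : Type*} [NontriviallyNormedField L] [IsUltrametricDist L] [CompleteSpace L]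

/-- **Dominant term.** Let `G ∈ 𝒪_L⟦X⟧`, `‖ω‖ < 1`, and suppose the coefficient `G_s` is a unit of
`𝒪_L` (`‖G_s‖ = 1`) while `‖G_k‖ ≤ c` for `k < s` with `c < ‖ω‖^s`. Then `‖G(ω)‖ = ‖ω‖^s`: the terms
of index `< s` have norm `≤ c`, those of index `> s` have norm `≤ ‖ω‖^{s+1}`, both `< ‖ω‖^s`.
This is the estimate behind the `p`-adic Weierstrass preparation theorem (Washington §7.1) as used in
de Shalit's uniqueness argument. [cite: Washington1997, §7.1 (Thm. 7.3, proof)] -/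
theorem norm_aeval_eq_of_dominant (G : PowerSeries (unitBall L)) {ω : unitBall L}
    (hω : ‖(ω : L)‖ < 1) {s : ℕ} {c : ℝ} (hs : ‖((PowerSeries.coeff s G : unitBall L) : L)‖ = 1)
    (hc : ∀ k < s, ‖((PowerSeries.coeff k G : unitBall L) : L)‖ ≤ c) (hcs : c < ‖(ω : L)‖ ^ s) :
    ‖((PowerSeries.aeval (isTopologicallyNilpotent_of_norm_lt_one L hω) G : unitBall L) : L)‖ =
      ‖(ω : L)‖ ^ s := by
  classical
  have hsum : Summable fun j => PowerSeries.coeff j G * ω ^ j := by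
    simpa using summable_coeff_mul_pow G hω 0
  rw [aeval_eq_tsum_coeff_mul_pow G hω, hsum.tsum_eq_add_tsum_ite s]
  -- the dominant term
  have hmain : ‖((PowerSeries.coeff s G * ω ^ s : unitBall L) : L)‖ = ‖(ω : L)‖ ^ s := by
    rw [Subring.coe_mul, SubmonoidClass.coe_pow, norm_mul, norm_pow, hs, one_mul]
  -- norm of `ω^s` is positive unless `s = 0`
  have hωs_pos : 0 < ‖(ω : L)‖ ^ s := by
    rcases Nat.eq_zero_or_pos s with rfl | hs0
    · rw [pow_zero]; exact one_pos
    · exact lt_of_le_of_lt ((norm_nonneg _).trans (hc 0 hs0)) hcs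
  -- the bound on the remaining terms
  set C : ℝ := max c (‖(ω : L)‖ ^ (s + 1)) with hC
  have hC_lt : C < ‖(ω : L)‖ ^ s := by
    refine max_lt hcs ?_
    rw [pow_succ]
    calc ‖(ω : L)‖ ^ s * ‖(ω : L)‖ < ‖(ω : L)‖ ^ s * 1 := by gcongr
      _ = ‖(ω : L)‖ ^ s := mul_one _
  have hrest : ‖((∑' j, (if j = s then 0 else PowerSeries.coeff j G * ω ^ j) : unitBall L) : L)‖ ≤
      max C 0 := by
    change ‖(∑' j, (if j = s then 0 else PowerSeries.coeff j G * ω ^ j) : unitBall L)‖ ≤ _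
    refine IsUltrametricDist.norm_tsum_le_of_forall_le_of_nonneg (le_max_right _ _) fun j => ?_
    split_ifs with hj
    · rw [norm_zero]; exact le_max_right _ _
    · refine le_trans ?_ (le_max_left _ _)
      change ‖((PowerSeries.coeff j G * ω ^ j : unitBall L) : L)‖ ≤ C
      rw [Subring.coe_mul, SubmonoidClass.coe_pow, norm_mul, norm_pow]
      rcases Nat.lt_or_gt_of_ne hj with hlt | hgt
      · calc ‖((PowerSeries.coeff j G : unitBall L) : L)‖ * ‖(ω : L)‖ ^ j
            ≤ c * 1 := by
              refine mul_le_mul (hc j hlt) (pow_le_one₀ (norm_nonneg _) hω.le)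
                (pow_nonneg (norm_nonneg _) _) ((norm_nonneg _).trans (hc j hlt))
          _ ≤ C := by rw [mul_one]; exact le_max_left _ _
      · calc ‖((PowerSeries.coeff j G : unitBall L) : L)‖ * ‖(ω : L)‖ ^ j
            ≤ 1 * ‖(ω : L)‖ ^ (s + 1) := by
              refine mul_le_mul (norm_coe_unitBall_le _)
                (pow_le_pow_of_le_one (norm_nonneg _) hω.le (by omega))
                (pow_nonneg (norm_nonneg _) _) zero_le_one
          _ ≤ C := by rw [one_mul]; exact le_max_right _ _
  have hrest_lt : ‖((∑' j, (if j = s then 0 else PowerSeries.coeff j G * ω ^ j) : unitBall L) : L)‖ <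
      ‖((PowerSeries.coeff s G * ω ^ s : unitBall L) : L)‖ := by
    rw [hmain]
    exact lt_of_le_of_lt hrest (max_lt hC_lt hωs_pos)
  rw [Subring.coe_add, IsUltrametricDist.norm_add_eq_max_of_norm_ne_norm hrest_lt.ne', max_eq_left
    hrest_lt.le, hmain]

end Dominant

/-! ### The `π`-content and the Weierstrass degree of a non-zero `d ∈ 𝒪_F⟦X⟧` -/

section LocalFieldZ

open GaloisRepresentations.IsNonarchimedeanLocalField LubinTate

variable (F : Type*) [Field F] [ValuativeRel F] [TopologicalSpace F] [IsNonarchimedeanLocalField F]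

attribute [local instance] ltNormUniformSpace ltNormIsUniformAddGroup rk1 nF nE fintypeResidueField

variable {F}
variable {π : 𝒪[F]} (hπ : (valuation F).IsUniformizer (π : F))

include hπ in
/-- A non-zero element of `𝒪[F]` is not divisible by all powers of `π` (`𝒪_F` is a discrete
valuation ring: `a = π^k u`). [cite: SerreLocalFields1979, Ch. I §1] -/
theorem exists_not_pow_dvd {a : 𝒪[F]} (ha : a ≠ 0) : ∃ k : ℕ, ¬ π ^ k ∣ a := by
  obtain ⟨k, u, rfl⟩ := exists_eq_pow_mul_unit hπ ha
  refine ⟨k + 1, fun h => ?_⟩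
  obtain ⟨c, hc⟩ := h
  have hπ0 : (π : 𝒪[F]) ≠ 0 := fun h0 => hπ.ne_zero (by rw [h0]; rfl)
  have h1 : (u : 𝒪[F]) = π * c := by
    rw [pow_succ, mul_assoc] at hc
    exact mul_left_cancel₀ (pow_ne_zero k hπ0) hc
  have h2 : IsUnit (π : 𝒪[F]) := isUnit_of_mul_isUnit_left (h1 ▸ u.isUnit)
  have h3 : valuation F (π : F) = 1 :=
    (Valuation.Integers.isUnit_iff_valuation_eq_one (Valuation.integer.integers (valuation F))).mp h2
  exact absurd h3 (ne_of_lt hπ.val_lt_one)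

include hπ in
/-- A non-unit of `𝒪[F]` is divisible by `π` (the maximal ideal is `π𝒪_F`).
[cite: SerreLocalFields1979, Ch. I §1] -/
theorem dvd_of_not_isUnit {a : 𝒪[F]} (ha : ¬ IsUnit a) : π ∣ a := by
  refine dvd_of_mem_maximalIdeal F hπ ?_
  exact (IsLocalRing.mem_maximalIdeal _).mpr ha

include hπ in
/-- **`π`-content and Weierstrass degree.** A non-zero `d ∈ 𝒪_F⟦X⟧` is `π^a · d₀` where, for some
`s`, the coefficient of `X^s` in `d₀` is a unit and the coefficients of lower degree are divisible by
`π` — the decomposition `f = π^μ · (unit-coefficient series)` that opens the proof of the `p`-adic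
Weierstrass preparation theorem. [cite: Washington1997, §7.1 (Thm. 7.3, proof)] -/
theorem exists_eq_C_pow_mul {d : PowerSeries (LTCoeff F)} (hd : d ≠ 0) :
    ∃ (a s : ℕ) (d₀ : PowerSeries (LTCoeff F)), d = PowerSeries.C (LTCoeff.of F π ^ a) * d₀ ∧
      IsUnit (PowerSeries.coeff s d₀) ∧ ∀ k < s, LTCoeff.of F π ∣ PowerSeries.coeff k d₀ := by
  classical
  -- some coefficient is not divisible by some power of `π`
  have hex : ∃ a : ℕ, ∃ k : ℕ, ¬ LTCoeff.of F π ^ (a + 1) ∣ PowerSeries.coeff k d := by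
    obtain ⟨k, hk⟩ : ∃ k, PowerSeries.coeff k d ≠ 0 := by
      by_contra h
      push Not at h
      exact hd (PowerSeries.ext fun k => by rw [h k, map_zero])
    have hk' : (LTCoeff.of F).symm (PowerSeries.coeff k d) ≠ 0 := by
      intro h0; exact hk (by simpa using congrArg (LTCoeff.of F) h0)
    obtain ⟨j, hj⟩ := exists_not_pow_dvd hπ hk'
    rcases j with _ | j
    · exact (hj (by rw [pow_zero]; exact one_dvd _)).elim
    · refine ⟨j, k, fun h => hj ?_⟩
      obtain ⟨c, hc⟩ := h
      refine ⟨(LTCoeff.of F).symm c, (LTCoeff.of F).injective ?_⟩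
      rw [map_mul, map_pow, RingEquiv.apply_symm_apply, RingEquiv.apply_symm_apply]
      exact hc
  let a := Nat.find hex
  have ha : ∃ k, ¬ LTCoeff.of F π ^ (a + 1) ∣ PowerSeries.coeff k d := Nat.find_spec hex
  have hmin : ∀ k, LTCoeff.of F π ^ a ∣ PowerSeries.coeff k d := by
    intro k
    rcases Nat.eq_zero_or_pos a with h0 | hpos
    · rw [h0, pow_zero]; exact one_dvd _
    · by_contra hk
      have : a - 1 < a := Nat.sub_lt hpos one_pos
      exact Nat.find_min hex this ⟨k, by rwa [Nat.sub_add_cancel hpos]⟩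
  choose e he using hmin
  set d₀ : PowerSeries (LTCoeff F) := PowerSeries.mk e with hd₀
  have hdd : d = PowerSeries.C (LTCoeff.of F π ^ a) * d₀ := by
    ext k
    rw [PowerSeries.coeff_C_mul, hd₀, PowerSeries.coeff_mk]
    exact he k
  -- a coefficient of `d₀` is a unit
  have hunit : ∃ s, IsUnit (PowerSeries.coeff s d₀) := by
    obtain ⟨k, hk⟩ := ha
    refine ⟨k, ?_⟩
    by_contra hnu
    have hnu' : ¬ IsUnit ((LTCoeff.of F).symm (PowerSeries.coeff k d₀)) := fun h =>
      hnu (by simpa using h.map (LTCoeff.of F))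
    obtain ⟨c, hc⟩ := dvd_of_not_isUnit hπ hnu'
    apply hk
    refine ⟨LTCoeff.of F c, ?_⟩
    rw [he k, show PowerSeries.coeff k d₀ = e k from by rw [hd₀, PowerSeries.coeff_mk]] at *
    have : e k = LTCoeff.of F π * LTCoeff.of F c := by
      have := congrArg (LTCoeff.of F) hc
      rwa [RingEquiv.apply_symm_apply, map_mul] at this
    rw [this, pow_succ, mul_assoc]
  refine ⟨a, Nat.find hunit, d₀, hdd, Nat.find_spec hunit, fun k hk => ?_⟩
  have hnu : ¬ IsUnit (PowerSeries.coeff k d₀) := Nat.find_min hunit hk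
  have hnu' : ¬ IsUnit ((LTCoeff.of F).symm (PowerSeries.coeff k d₀)) := fun h =>
    hnu (by simpa using h.map (LTCoeff.of F))
  obtain ⟨c, hc⟩ := dvd_of_not_isUnit hπ hnu'
  refine ⟨LTCoeff.of F c, ?_⟩
  have := congrArg (LTCoeff.of F) hc
  rwa [RingEquiv.apply_symm_apply, map_mul] at this

/-! ### Values at points close to the unit circle -/

variable (E : IntermediateField F (AlgebraicClosure F)) [FiniteDimensional F E]

/-- Points of `𝔪_E` have norm `< 1` (unfolding). [folklore] -/
private theorem norm_coe_pt_lt_one (x : (maxNilIdeal F E).toIdeal) : ‖((x : unitBall E) : E)‖ < 1 := x.2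

/-- `evalAt` at a point of `𝔪_E` is the `tsum`-evaluation of the mapped series at the underlying
element of `𝒪_E` (unfolding through `evalAt_eq_evS_map`). [folklore] -/
private theorem evalAt_eq_aeval_map (x : (maxNilIdeal F E).toIdeal) (h : PowerSeries (LTCoeff F)) :
    evalAt (maxNilIdeal F E) x h =
      PowerSeries.aeval (isTopologicallyNilpotent_of_norm_lt_one E (norm_coe_pt_lt_one E x))
        (h.map (algebraMap (LTCoeff F) (unitBall E))) := by
  rw [evalAt_eq_evS_map]
  rfl

omit hπ in
/-- A unit of `𝒪[F]` has norm `1` in `F`. [cite: SerreLocalFields1979, Ch. I §1] -/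
theorem norm_coe_eq_one_of_isUnit {u : 𝒪[F]} (hu : IsUnit u) : ‖(u : F)‖ = 1 := by
  have hv : valuation F (u : F) = 1 :=
    (Valuation.Integers.isUnit_iff_valuation_eq_one (Valuation.integer.integers (valuation F))).mp hu
  exact le_antisymm (Valued.toNormedField.norm_le_one_iff.mpr hv.le)
    (Valued.toNormedField.one_le_norm_iff.mpr hv.ge)

omit hπ in
/-- A multiple of `π` in `𝒪[F]` has norm `≤ ‖π‖`. [cite: SerreLocalFields1979, Ch. I §1] -/
theorem norm_coe_le_of_dvd {a : 𝒪[F]} (h : π ∣ a) : ‖(a : F)‖ ≤ ‖(π : F)‖ := by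
  obtain ⟨c, rfl⟩ := h
  rw [Subring.coe_mul, norm_mul]
  calc ‖(π : F)‖ * ‖(c : F)‖ ≤ ‖(π : F)‖ * 1 := by
        gcongr; exact Valued.toNormedField.norm_le_one_iff.mpr c.2
    _ = ‖(π : F)‖ := mul_one _

omit hπ in
/-- **`‖d₀(x)‖ = ‖x‖^s`** when the degree-`s` coefficient of `d₀ ∈ 𝒪_F⟦X⟧` is a unit, the lower ones
are divisible by `π`, and `‖π‖ < ‖x‖^s` (`x ∈ 𝔪_E`): the Weierstrass-preparation estimate behind
de Shalit's "the Weierstrass preparation theorem shows that `g` is unique".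
[cite: deShalit1987, Ch. I §2.2 Theorem (proof, uniqueness)] -/
theorem norm_evalAt_eq_of_isUnit_coeff {d₀ : PowerSeries (LTCoeff F)} {s : ℕ}
    (hs : IsUnit (PowerSeries.coeff s d₀)) (hlow : ∀ k < s, LTCoeff.of F π ∣ PowerSeries.coeff k d₀)
    (x : (maxNilIdeal F E).toIdeal) (hx : ‖(π : F)‖ < ‖((x : unitBall E) : E)‖ ^ s) :
    ‖((evalAt (maxNilIdeal F E) x d₀ : unitBall E) : E)‖ = ‖((x : unitBall E) : E)‖ ^ s := by
  rw [evalAt_eq_aeval_map]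
  refine norm_aeval_eq_of_dominant _ (norm_coe_pt_lt_one E x) ?_ (c := ‖(π : F)‖) ?_ hx
  · rw [PowerSeries.coeff_map]
    have e : PowerSeries.coeff s d₀ = LTCoeff.of F ((LTCoeff.of F).symm (PowerSeries.coeff s d₀)) :=
      (RingEquiv.apply_symm_apply _ _).symm
    rw [e, norm_algebraMap_LTCoeff]
    exact norm_coe_eq_one_of_isUnit (hs.map _)
  · intro k hk
    rw [PowerSeries.coeff_map]
    have e : PowerSeries.coeff k d₀ = LTCoeff.of F ((LTCoeff.of F).symm (PowerSeries.coeff k d₀)) :=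
      (RingEquiv.apply_symm_apply _ _).symm
    rw [e, norm_algebraMap_LTCoeff]
    refine norm_coe_le_of_dvd ?_
    obtain ⟨c, hc⟩ := hlow k hk
    refine ⟨(LTCoeff.of F).symm c, (LTCoeff.of F).injective ?_⟩
    rw [map_mul, RingEquiv.apply_symm_apply, RingEquiv.apply_symm_apply]
    exact hc

include hπ in
/-- **A non-zero `d ∈ 𝒪_F⟦X⟧` has no zeros close to the unit circle**: there is `N` (the Weierstrass
degree of `d/π^a`) such that `d(x) ≠ 0` for every point `x` of the open unit disc of any finite
`E/F` with `‖π‖ < ‖x‖^N`; quantitatively `‖d(x)‖ = ‖π‖^a ‖x‖^N`.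
[cite: deShalit1987, Ch. I §2.2 (proof, uniqueness)] -/
theorem exists_forall_norm_evalAt_eq {d : PowerSeries (LTCoeff F)} (hd : d ≠ 0) :
    ∃ a N : ℕ, ∀ (E : IntermediateField F (AlgebraicClosure F)) [FiniteDimensional F E]
      (x : (maxNilIdeal F E).toIdeal), ‖(π : F)‖ < ‖((x : unitBall E) : E)‖ ^ N →
        ‖((evalAt (maxNilIdeal F E) x d : unitBall E) : E)‖ =
          ‖(π : F)‖ ^ a * ‖((x : unitBall E) : E)‖ ^ N := by
  obtain ⟨a, s, d₀, rfl, hs, hlow⟩ := exists_eq_C_pow_mul hπ hd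
  refine ⟨a, s, fun E _ x hx => ?_⟩
  rw [map_mul, Subring.coe_mul, norm_mul, norm_evalAt_eq_of_isUnit_coeff E hs hlow x hx]
  congr 1
  rw [PowerSeries.C_eq_algebraMap, AlgHom.commutes, ← map_pow, norm_algebraMap_LTCoeff,
    SubmonoidClass.coe_pow, norm_pow]

include hπ in
/-- **A non-zero `d ∈ 𝒪_F⟦X⟧` does not vanish at points `x` with `‖π‖ < ‖x‖^N`.**
[cite: deShalit1987, Ch. I §2.2 (proof, uniqueness)] -/
theorem exists_forall_evalAt_ne_zero {d : PowerSeries (LTCoeff F)} (hd : d ≠ 0) :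
    ∃ N : ℕ, ∀ (E : IntermediateField F (AlgebraicClosure F)) [FiniteDimensional F E]
      (x : (maxNilIdeal F E).toIdeal), ‖(π : F)‖ < ‖((x : unitBall E) : E)‖ ^ N →
        evalAt (maxNilIdeal F E) x d ≠ 0 := by
  obtain ⟨a, N, h⟩ := exists_forall_norm_evalAt_eq hπ hd
  refine ⟨N, fun E _ x hx h0 => ?_⟩
  have h1 := h E x hx
  rw [h0, ZeroMemClass.coe_zero, norm_zero] at h1
  have hπpos : 0 < ‖(π : F)‖ := norm_pos_iff.mpr hπ.ne_zero
  have hxpos : 0 < ‖((x : unitBall E) : E)‖ ^ N := hπpos.trans hx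
  exact absurd h1.symm (mul_pos (pow_pos hπpos _) hxpos).ne'

/-! ### Application to the division points of the Lubin–Tate tower -/

include hπ in
/-- **`‖[u] x‖ = ‖x‖` for a unit `u ∈ 𝒪_Fˣ`** and any point `x ∈ 𝔪_E` (`[u]X = uX + O(X²)` with integral
coefficients): all primitive division points of a given level have the same absolute value.
[cite: deShalit1987, Ch. I §1.8] -/
theorem norm_ltSMul_of_isUnit {u : 𝒪[F]} (hu : IsUnit u) (x : (maxNilIdeal F E).toIdeal) :
    ‖(((ltSMul (maxNilIdeal F E) (isLTRing_LTCoeff hπ) (isLTSeries_LTCoeff π)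
        (LTCoeff.of F u) x : (maxNilIdeal F E).toIdeal) : unitBall E) : E)‖ =
      ‖((x : unitBall E) : E)‖ := by
  by_cases hx0 : x = 0
  · subst hx0
    rw [ltSMul_zero]
  -- `[u] x = h(x)` with `h = [u]_f`, `h₀ = 0`, `h₁ = u`
  have e : ((ltSMul (maxNilIdeal F E) (isLTRing_LTCoeff hπ) (isLTSeries_LTCoeff π) (LTCoeff.of F u) x :
      (maxNilIdeal F E).toIdeal) : unitBall E) =
      evalAt (maxNilIdeal F E) x (hom (isLTRing_LTCoeff hπ) (isLTSeries_LTCoeff π)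
        (isLTSeries_LTCoeff π) (LTCoeff.of F u)) := by
    rw [ltSMul, ← coe_evalPt₁_eq_evalAt]
  rw [e, evalAt_eq_aeval_map]
  have hxpos : 0 < ‖((x : unitBall E) : E)‖ := by
    refine norm_pos_iff.mpr fun h0 => hx0 ?_
    exact Subtype.ext (Subtype.ext h0)
  have h1 := norm_aeval_eq_of_dominant ((hom (isLTRing_LTCoeff hπ) (isLTSeries_LTCoeff π)
      (isLTSeries_LTCoeff π) (LTCoeff.of F u)).map (algebraMap (LTCoeff F) (unitBall E)))
      (norm_coe_pt_lt_one E x) (s := 1) (c := 0) ?_ ?_ (by rw [pow_one]; exact hxpos)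
  · rw [h1, pow_one]
  · rw [PowerSeries.coeff_map, coeff_one_hom, norm_algebraMap_LTCoeff]
    exact norm_coe_eq_one_of_isUnit hu
  · intro k hk
    have hk0 : k = 0 := by omega
    subst hk0
    rw [PowerSeries.coeff_map, PowerSeries.coeff_zero_eq_constantCoeff, constantCoeff_hom, map_zero,
      ZeroMemClass.coe_zero, norm_zero]

variable (n : ℕ)

include hπ in
/-- **`‖π‖ < ‖λ_{n+1}‖^N` for `N < (q-1)qⁿ`** (from `‖λ_{n+1}‖^{(q-1)qⁿ} = ‖π‖` and `‖λ_{n+1}‖ < 1`).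
[cite: CasselsFrohlichANT1967, Ch. VI §3.6 Cor. to Prop. 6] -/
theorem norm_pi_lt_norm_genPt_pow {N : ℕ} (hN : N < (residueFieldCard F - 1) * residueFieldCard F ^ n) :
    ‖(π : F)‖ < ‖(((genPt hπ n : (maxNilIdeal F (ltField π n)).toIdeal) : unitBall (ltField π n)) :
      ltField π n)‖ ^ N := by
  change ‖(π : F)‖ < ‖(IntermediateField.AdjoinSimple.gen F (ltRoot π n) : ltField π n)‖ ^ N
  rw [← norm_gen_ltField_pow hπ n]
  have hlt1 : ‖(IntermediateField.AdjoinSimple.gen F (ltRoot π n) : ltField π n)‖ < 1 :=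
    norm_gen_ltField_lt_one hπ n
  have hpos : 0 < ‖(IntermediateField.AdjoinSimple.gen F (ltRoot π n) : ltField π n)‖ := by
    by_contra h
    have h0 : ‖(IntermediateField.AdjoinSimple.gen F (ltRoot π n) : ltField π n)‖ = 0 :=
      le_antisymm (not_lt.mp h) (norm_nonneg _)
    have := norm_gen_ltField_pow hπ n
    rw [h0, zero_pow (Nat.pos_iff_ne_zero.mp (lt_of_le_of_lt (Nat.zero_le _) hN))] at this
    exact hπ.ne_zero (norm_eq_zero.mp this.symm)
  exact pow_lt_pow_right_of_lt_one₀ hpos hlt1 hN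

omit hπ in
/-- The level index `(q-1)qⁿ` tends to infinity: `N < (q-1)qⁿ` for `n ≥ N`. [folklore] -/
private theorem lt_index_of_le {N n : ℕ} (hn : N ≤ n) : N < (residueFieldCard F - 1) * residueFieldCard F ^ n := by
  have hq : 1 < residueFieldCard F := one_lt_residueFieldCard F
  have h1 : n < residueFieldCard F ^ n := Nat.lt_pow_self hq
  have h2 : residueFieldCard F ^ n ≤ (residueFieldCard F - 1) * residueFieldCard F ^ n :=
    Nat.le_mul_of_pos_left _ (by omega)
  omega

include hπ in
/-- **Uniqueness of the Coleman power series** (de Shalit I §2.2; Coleman 1979 Thm. A): if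
`d ∈ 𝒪_F⟦X⟧` vanishes at a primitive division point `[u_n] λ_{n+1}` (`u_n ∈ 𝒪_Fˣ`) of level `n+1`
for infinitely many `n`, then `d = 0`. [cite: deShalit1987, Ch. I §2.2 Theorem (uniqueness)] -/
theorem eq_zero_of_frequently_evalAt_ltSMul_genPt_eq_zero {d : PowerSeries (LTCoeff F)}
    (u : ℕ → 𝒪[F]) (hu : ∀ n, IsUnit (u n))
    (h : ∃ᶠ n in atTop, evalAt (maxNilIdeal F (ltField π n))
      (ltSMul (maxNilIdeal F (ltField π n)) (isLTRing_LTCoeff hπ) (isLTSeries_LTCoeff π)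
        (LTCoeff.of F (u n)) (genPt hπ n)) d = 0) :
    d = 0 := by
  by_contra hd
  obtain ⟨N, hN⟩ := exists_forall_evalAt_ne_zero hπ hd
  obtain ⟨n, hzero, hn⟩ := (h.and_eventually (eventually_ge_atTop N)).exists
  refine hN (ltField π n) _ ?_ hzero
  rw [norm_ltSMul_of_isUnit hπ (ltField π n) (hu n)]
  exact norm_pi_lt_norm_genPt_pow hπ n (lt_index_of_le hn)

include hπ in
/-- **Uniqueness of the Coleman power series, two-series form**: two series in `𝒪_F⟦X⟧` taking the
same value at a primitive division point of level `n+1` for infinitely many `n` are equal.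
[cite: deShalit1987, Ch. I §2.2 Theorem (uniqueness)] -/
theorem eq_of_frequently_evalAt_ltSMul_genPt_eq {g g' : PowerSeries (LTCoeff F)}
    (u : ℕ → 𝒪[F]) (hu : ∀ n, IsUnit (u n))
    (h : ∃ᶠ n in atTop, evalAt (maxNilIdeal F (ltField π n))
      (ltSMul (maxNilIdeal F (ltField π n)) (isLTRing_LTCoeff hπ) (isLTSeries_LTCoeff π)
        (LTCoeff.of F (u n)) (genPt hπ n)) g =
      evalAt (maxNilIdeal F (ltField π n))
      (ltSMul (maxNilIdeal F (ltField π n)) (isLTRing_LTCoeff hπ) (isLTSeries_LTCoeff π)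
        (LTCoeff.of F (u n)) (genPt hπ n)) g') :
    g = g' := by
  rw [← sub_eq_zero]
  refine eq_zero_of_frequently_evalAt_ltSMul_genPt_eq_zero hπ u hu (h.mono fun n hn => ?_)
  rw [map_sub, hn, sub_self]

include hπ in
/-- **Uniqueness at the canonical generators**: a series vanishing at `λ_{n+1}` for infinitely many `n`
is `0`. [cite: deShalit1987, Ch. I §2.2 Theorem (uniqueness)] -/
theorem eq_zero_of_frequently_evalAt_genPt_eq_zero {d : PowerSeries (LTCoeff F)}
    (h : ∃ᶠ n in atTop, evalAt (maxNilIdeal F (ltField π n)) (genPt hπ n) d = 0) : d = 0 := by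
  refine eq_zero_of_frequently_evalAt_ltSMul_genPt_eq_zero hπ (fun _ => 1) (fun _ => isUnit_one)
    (h.mono fun n hn => ?_)
  rwa [map_one, one_ltSMul]

end LocalFieldZ

end LubinTate

end Literature.NumberTheory.GaloisRepresentations
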